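import Literature.MathematicalPhysics.QuantumManyBody.BogoliubovTrialEnergyDecay
import Literature.MathematicalPhysics.QuantumManyBody.CubicTrialVectorDefectPairs
import HarnessLib

/-!
# The trial functional of the cubic vector with weighted pair coincidences

Topic `Literature/MathematicalPhysics/QuantumManyBody`, namespace `BoseGas.Fock`; theorem-only sequel of
`BogoliubovTrialEnergyDecay.lean` for the provefact
`Literature.MathematicalPhysics.QuantumManyBody.BoseGas.BastiCenatiempoSchlein2021_upperBound`.

The same three reductions (`re_cubicBlock_cubicVector_le'''`, `re_hardBlock_cubicVector_le'''`,
`trialNumerator_cubicVector_le'''`) with the cutoff defects controlled by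
`sum_mul_defect_le_weighted`: the two-index coincidences by the sups `F₁, F₁^V` of the decaying
weights as before, the three-index ones by the weighted sums
`F₂ ≥ ∑_{τⱼ,τₖ}|κ_{τⱼ}|²|κ_{τₖ}|²∑_τ[C₂]g_τ` (`g` the cubic weight `|c̃_τ||κ_τ|`, resp. the pair weight
`g_V`), entering the errors linearly (`F₂` instead of `F₂K₁²`) — the form in which the bounds for
`W₃, W₄` and `X₂` of [BastiCenatiempoSchlein2021, §5.2–§5.3] are summable.

## References

* [BastiCenatiempoSchlein2021] G. Basti, S. Cenatiempo, B. Schlein, Forum Math. Sigma 9 (2021) e74,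
  arXiv:2101.06222: Prop. 3.1, Prop. 3.2, §5.2 (5.11), (5.15)–(5.17), §5.3 (5.14), (W₁)–(W₄).
-/

noncomputable section

namespace Literature.MathematicalPhysics.QuantumManyBody.BoseGas

open Complex MvPolynomial Finset
open scoped ComplexConjugate BigOperators

namespace Fock

variable {ι : Type*} [DecidableEq ι] [LinearOrder ι] {e : ι → Momentum} {PH PS : Finset ι}

section Blocks

variable [Fintype ι] {σ : ι → ι} {P : Finset ι} {t : ι → ℝ}

/-- **The cubic block of the cubic vector, freed and bounded.** With `T = ⟨ξ_ν, a†_ia†_ja†_kξ_ν⟩`,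
the real part of the triple-form cubic block `∑_{mom}(F·T + G·T̄)` equals
`Re ∑ cubicCoeff·T = Re[(∑_τ c̃_τ conj κ_τ)]‖ξ_ν‖² - Re ∑_τ c̃_τ conj κ_τ D_τ` and the defect part is
at most `(F₁K₁ + F₂K₁²)‖ξ_ν‖²` (coincidence sups `F₁, F₂` of the decaying weight `|c̃_τ||κ_τ|`) — the main term
`⟨ξ_ν, 𝒞_Nξ_ν⟩ = I + J` of [ibid., (5.8)–(5.11)] together with the crude treatment of `F₁`–`F₃`.
[cite: BastiCenatiempoSchlein2021, §4 (`𝒞_N`, `F₁`–`F₃`), §5.2 (5.8)–(5.17)] -/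
theorem re_cubicBlock_cubicVector_le'' (he : Function.Injective e) (hHS : Disjoint PH PS)
    (κ : Triple e PH PS → ℂ) (W : Momentum → ℂ) {F₁ F₂ : ℝ} (hF₁ : 0 ≤ F₁)
    (hF₁le : ∀ τ' : Triple e PH PS, ∑ τ : Triple e PH PS,
      (if τ.b = τ'.b ∨ (∃ p, (p = τ.u ∨ p = τ.a) ∧ (p = τ'.u ∨ p = τ'.a)) ∨
          (∃ p, (p = τ.u ∨ p = τ.a) ∧ e p + e p + e τ'.b = 0) ∨ (∃ p', (p' = τ'.u ∨ p' = τ'.a) ∧ e p' + e p' + e τ.b = 0)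
        then ‖arrSum (cubicCoeff e W (bogGamma σ P t) (bogSigma σ P t)) τ‖ * ‖κ τ‖ else 0) ≤ F₁)
    (hF₂le : ∑ τj : Triple e PH PS, ∑ τk : Triple e PH PS, ‖κ τj‖ ^ 2 * ‖κ τk‖ ^ 2 * ∑ τ : Triple e PH PS,
      (if (∃ pj pk, (pj = τj.u ∨ pj = τj.a) ∧ (pk = τk.u ∨ pk = τk.a) ∧ e pj + e pk + e τ.b = 0) ∨
          (∃ p pk, (p = τ.u ∨ p = τ.a) ∧ (pk = τk.u ∨ pk = τk.a) ∧ e p + e pk + e τj.b = 0)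
        then ‖arrSum (cubicCoeff e W (bogGamma σ P t) (bogSigma σ P t)) τ‖ * ‖κ τ‖ else 0) ≤ F₂) :
    (∑ i, ∑ j, ∑ k, (if e i + e j + e k = 0 then
        ((W (-e k) + W (e j)) * ((bogGamma σ P t i * bogSigma σ P t j * bogSigma σ P t k : ℝ) : ℂ) +
            (W (-e i) + W (e j)) * ((bogGamma σ P t i * bogGamma σ P t j * bogSigma σ P t k : ℝ) : ℂ)) *
          fockInner (cubicVector e PH PS κ) (X i * (X j * (X k * cubicVector e PH PS κ))) +
        ((W (e k) + W (-e j)) * ((bogGamma σ P t i * bogSigma σ P t j * bogSigma σ P t k : ℝ) : ℂ) +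
            (W (e i) + W (-e j)) * ((bogGamma σ P t i * bogGamma σ P t j * bogSigma σ P t k : ℝ) : ℂ)) *
          fockInner (X i * (X j * (X k * cubicVector e PH PS κ))) (cubicVector e PH PS κ) else 0)).re ≤
      (∑ τ : Triple e PH PS, arrSum (cubicCoeff e W (bogGamma σ P t) (bogSigma σ P t)) τ * conj (κ τ)).re * cubicNormSq κ +
        (F₁ * ampNormSq κ + F₂) * cubicNormSq κ := by
  set ξ := cubicVector e PH PS κ with hξ
  set cc := cubicCoeff e W (bogGamma σ P t) (bogSigma σ P t) with hcc
  -- pointwise: the real part only sees `cubicCoeff · T`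
  have hpt : ∀ i j k, (if e i + e j + e k = 0 then
      ((W (-e k) + W (e j)) * ((bogGamma σ P t i * bogSigma σ P t j * bogSigma σ P t k : ℝ) : ℂ) +
          (W (-e i) + W (e j)) * ((bogGamma σ P t i * bogGamma σ P t j * bogSigma σ P t k : ℝ) : ℂ)) *
        fockInner ξ (X i * (X j * (X k * ξ))) +
      ((W (e k) + W (-e j)) * ((bogGamma σ P t i * bogSigma σ P t j * bogSigma σ P t k : ℝ) : ℂ) +
          (W (e i) + W (-e j)) * ((bogGamma σ P t i * bogGamma σ P t j * bogSigma σ P t k : ℝ) : ℂ)) *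
        fockInner (X i * (X j * (X k * ξ))) ξ else 0).re = (cc i j k * fockInner ξ (X i * (X j * (X k * ξ)))).re := by
    intro i j k
    simp only [hcc, cubicCoeff]
    by_cases hm : e i + e j + e k = 0
    · rw [if_pos hm, if_pos hm, fockInner_create_self_eq_conj]
      simp only [Complex.add_re, Complex.mul_re, Complex.conj_re, Complex.conj_im, add_mul, Complex.add_im,
        Complex.mul_im]
      ring
    · rw [if_neg hm, if_neg hm, zero_mul]
  have hL : (∑ i, ∑ j, ∑ k, (if e i + e j + e k = 0 then
      ((W (-e k) + W (e j)) * ((bogGamma σ P t i * bogSigma σ P t j * bogSigma σ P t k : ℝ) : ℂ) +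
          (W (-e i) + W (e j)) * ((bogGamma σ P t i * bogGamma σ P t j * bogSigma σ P t k : ℝ) : ℂ)) *
        fockInner ξ (X i * (X j * (X k * ξ))) +
      ((W (e k) + W (-e j)) * ((bogGamma σ P t i * bogSigma σ P t j * bogSigma σ P t k : ℝ) : ℂ) +
          (W (e i) + W (-e j)) * ((bogGamma σ P t i * bogGamma σ P t j * bogSigma σ P t k : ℝ) : ℂ)) *
        fockInner (X i * (X j * (X k * ξ))) ξ else 0)).re =
      (∑ i, ∑ j, ∑ k, cc i j k * fockInner ξ (X i * (X j * (X k * ξ)))).re := by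
    simp only [Complex.re_sum, hpt]
  rw [hL, sum_mul_cubicExp_eq_freed' hHS κ cc, Complex.sub_re, Complex.re_mul_ofReal]
  -- the defect part
  have hdef : ‖∑ τ : Triple e PH PS, arrSum cc τ * conj (κ τ) * ((cutoffDefect κ τ : ℝ) : ℂ)‖ ≤
      (F₁ * ampNormSq κ + F₂) * cubicNormSq κ := by
    calc ‖∑ τ : Triple e PH PS, arrSum cc τ * conj (κ τ) * ((cutoffDefect κ τ : ℝ) : ℂ)‖
        ≤ ∑ τ : Triple e PH PS, (‖arrSum cc τ‖ * ‖κ τ‖) * cutoffDefect κ τ := by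
          refine norm_sum_le_of_le _ fun τ _ => ?_
          rw [norm_mul, norm_mul, Complex.norm_conj, Complex.norm_real, Real.norm_of_nonneg (cutoffDefect_nonneg_le κ τ).1]
      _ ≤ _ := sum_mul_defect_le_weighted he κ (fun τ => ‖arrSum cc τ‖ * ‖κ τ‖) (fun τ => by positivity) hF₁ hF₁le hF₂le
  have habs := Complex.abs_re_le_norm (∑ τ : Triple e PH PS, arrSum cc τ * conj (κ τ) * ((cutoffDefect κ τ : ℝ) : ℂ))
  rw [abs_le] at habs
  linarith [habs.1]

/-- **The hard pair-annihilation block of the cubic vector, bounded.** For `|W| ≤ W₀`, `|γ| ≤ g₀` on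
`P_H`, and the coincidence sups `F₁, F₂` of the decaying pair weight `g_V` (module docstring):
`Re ∑_{P_H⁴} cγγγγ⟨a_qa_pξ_ν, a_{q'}a_{p'}ξ_ν⟩ ≤ Re(∑_{b=b'} κ_{τ'}conj(κ_τ)K̃)‖ξ_ν‖²`
`+ [(F₁K₁+F₂K₁²) + 16W₀g₀⁴(K₁²+K₁)]‖ξ_ν‖²` — the main term (5.13) of `⟨ξ_ν,𝒱_N^{(H)}ξ_ν⟩`
with the errors (5.14) (pair cutoff defects) and `V₂` (two triples differ).
[cite: BastiCenatiempoSchlein2021, §5.3 (5.12)–(5.14), Prop. 3.2] -/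
theorem re_hardBlock_cubicVector_le'' (he : Function.Injective e) (hHS : Disjoint PH PS)
    (κ : Triple e PH PS → ℂ) (W : Momentum → ℂ) {W₀ : ℝ} (hW : ∀ k, ‖W k‖ ≤ W₀)
    {g₀ F₁ F₂ : ℝ} (hg₀ : 0 ≤ g₀) (hF₁ : 0 ≤ F₁)
    (hgH : ∀ p ∈ PH, |bogGamma σ P t p| ≤ g₀)
    (hF₁le : ∀ τ' : Triple e PH PS, ∑ τ : Triple e PH PS,
      (if τ.b = τ'.b ∨ (∃ p, (p = τ.u ∨ p = τ.a) ∧ (p = τ'.u ∨ p = τ'.a)) ∨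
          (∃ p, (p = τ.u ∨ p = τ.a) ∧ e p + e p + e τ'.b = 0) ∨ (∃ p', (p' = τ'.u ∨ p' = τ'.a) ∧ e p' + e p' + e τ.b = 0)
        then (‖κ τ‖ * ((∑ τ₂ : Triple e PH PS, (if τ₂.b = τ.b then ‖κ τ₂‖ * ‖(hardKernel e W (bogGamma σ P t) PH τ₂.u τ₂.a τ.u τ.a +
            hardKernel e W (bogGamma σ P t) PH τ₂.u τ₂.a τ.a τ.u + hardKernel e W (bogGamma σ P t) PH τ₂.a τ₂.u τ.u τ.a +
            hardKernel e W (bogGamma σ P t) PH τ₂.a τ₂.u τ.a τ.u)‖ else 0)) +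
          ∑ τ₁ : Triple e PH PS, (if τ.b = τ₁.b then ‖κ τ₁‖ * ‖(hardKernel e W (bogGamma σ P t) PH τ.u τ.a τ₁.u τ₁.a +
            hardKernel e W (bogGamma σ P t) PH τ.u τ.a τ₁.a τ₁.u + hardKernel e W (bogGamma σ P t) PH τ.a τ.u τ₁.u τ₁.a +
            hardKernel e W (bogGamma σ P t) PH τ.a τ.u τ₁.a τ₁.u)‖ else 0))) else 0) ≤ F₁)
    (hF₂le : ∑ τj : Triple e PH PS, ∑ τk : Triple e PH PS, ‖κ τj‖ ^ 2 * ‖κ τk‖ ^ 2 * ∑ τ : Triple e PH PS,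
      (if (∃ pj pk, (pj = τj.u ∨ pj = τj.a) ∧ (pk = τk.u ∨ pk = τk.a) ∧ e pj + e pk + e τ.b = 0) ∨
          (∃ p pk, (p = τ.u ∨ p = τ.a) ∧ (pk = τk.u ∨ pk = τk.a) ∧ e p + e pk + e τj.b = 0)
        then (‖κ τ‖ * ((∑ τ₂ : Triple e PH PS, (if τ₂.b = τ.b then ‖κ τ₂‖ * ‖(hardKernel e W (bogGamma σ P t) PH τ₂.u τ₂.a τ.u τ.a +
            hardKernel e W (bogGamma σ P t) PH τ₂.u τ₂.a τ.a τ.u + hardKernel e W (bogGamma σ P t) PH τ₂.a τ₂.u τ.u τ.a +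
            hardKernel e W (bogGamma σ P t) PH τ₂.a τ₂.u τ.a τ.u)‖ else 0)) +
          ∑ τ₁ : Triple e PH PS, (if τ.b = τ₁.b then ‖κ τ₁‖ * ‖(hardKernel e W (bogGamma σ P t) PH τ.u τ.a τ₁.u τ₁.a +
            hardKernel e W (bogGamma σ P t) PH τ.u τ.a τ₁.a τ₁.u + hardKernel e W (bogGamma σ P t) PH τ.a τ.u τ₁.u τ₁.a +
            hardKernel e W (bogGamma σ P t) PH τ.a τ.u τ₁.a τ₁.u)‖ else 0))) else 0) ≤ F₂) :
    (∑ p ∈ PH, ∑ q ∈ PH, ∑ p' ∈ PH, ∑ q' ∈ PH, pairCoeff' e W p q p' q' *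
        ((bogGamma σ P t q * bogGamma σ P t p * (bogGamma σ P t q' * bogGamma σ P t p') : ℝ) : ℂ) *
          fockInner (pderiv q (pderiv p (cubicVector e PH PS κ))) (pderiv q' (pderiv p' (cubicVector e PH PS κ)))).re ≤
      (∑ τ' : Triple e PH PS, ∑ τ : Triple e PH PS, (if τ.b = τ'.b then
          κ τ' * conj (κ τ) * (hardKernel e W (bogGamma σ P t) PH τ.u τ.a τ'.u τ'.a +
            hardKernel e W (bogGamma σ P t) PH τ.u τ.a τ'.a τ'.u + hardKernel e W (bogGamma σ P t) PH τ.a τ.u τ'.u τ'.a +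
            hardKernel e W (bogGamma σ P t) PH τ.a τ.u τ'.a τ'.u) else 0)).re * cubicNormSq κ +
        ((F₁ * ampNormSq κ + F₂) +
          16 * (W₀ * g₀ ^ 4) * (ampNormSq κ ^ 2 + ampNormSq κ)) * cubicNormSq κ := by
  have hW₀ : 0 ≤ W₀ := le_trans (norm_nonneg _) (hW 0)
  set gm := bogGamma σ P t with hgm
  set Kt : Triple e PH PS → Triple e PH PS → ℂ := fun τ' τ => hardKernel e W gm PH τ.u τ.a τ'.u τ'.a +
    hardKernel e W gm PH τ.u τ.a τ'.a τ'.u + hardKernel e W gm PH τ.a τ.u τ'.u τ'.a + hardKernel e W gm PH τ.a τ.u τ'.a τ'.u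
    with hKt
  obtain ⟨B, hB, hdec⟩ := quartic_pairing_decomposition' he hHS κ W hW gm hg₀ hgH
  rw [hdec, Complex.add_re]
  have hKt_fold : ∀ τ' τ, hardKernel e W gm PH τ.u τ.a τ'.u τ'.a + hardKernel e W gm PH τ.u τ.a τ'.a τ'.u +
      hardKernel e W gm PH τ.a τ.u τ'.u τ'.a + hardKernel e W gm PH τ.a τ.u τ'.a τ'.u = Kt τ' τ := fun _ _ => rfl
  simp only [hKt_fold]
  -- split main and pair-defect parts
  have hsplit : (∑ τ' : Triple e PH PS, ∑ τ : Triple e PH PS, (if τ.b = τ'.b then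
      κ τ' * conj (κ τ) * Kt τ' τ * (((cubicNormSq κ : ℝ) : ℂ) - ((pairCutoffDefect κ τ' τ : ℝ) : ℂ)) else 0)) =
      (∑ τ' : Triple e PH PS, ∑ τ : Triple e PH PS, (if τ.b = τ'.b then κ τ' * conj (κ τ) * Kt τ' τ else 0)) *
          ((cubicNormSq κ : ℝ) : ℂ) -
        ∑ τ' : Triple e PH PS, ∑ τ : Triple e PH PS, (if τ.b = τ'.b then
          κ τ' * conj (κ τ) * Kt τ' τ * ((pairCutoffDefect κ τ' τ : ℝ) : ℂ) else 0) := by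
    rw [Finset.sum_mul, ← Finset.sum_sub_distrib]
    refine Finset.sum_congr rfl fun τ' _ => ?_
    rw [Finset.sum_mul, ← Finset.sum_sub_distrib]
    refine Finset.sum_congr rfl fun τ _ => ?_
    split_ifs <;> ring
  rw [hsplit, Complex.sub_re, Complex.re_mul_ofReal]
  -- the pair-defect part
  have hD0 : ∀ τ, 0 ≤ cutoffDefect κ τ := fun τ => (cutoffDefect_nonneg_le κ τ).1
  have hpd : ‖∑ τ' : Triple e PH PS, ∑ τ : Triple e PH PS, (if τ.b = τ'.b then
      κ τ' * conj (κ τ) * Kt τ' τ * ((pairCutoffDefect κ τ' τ : ℝ) : ℂ) else 0)‖ ≤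
      (F₁ * ampNormSq κ + F₂) * cubicNormSq κ := by
    -- the decaying weight
    set gV : Triple e PH PS → ℝ := fun τ => ‖κ τ‖ * ((∑ τ₂ : Triple e PH PS, (if τ₂.b = τ.b then ‖κ τ₂‖ * ‖Kt τ τ₂‖ else 0)) +
      ∑ τ₁ : Triple e PH PS, (if τ.b = τ₁.b then ‖κ τ₁‖ * ‖Kt τ₁ τ‖ else 0)) with hgV
    have hgV0 : ∀ τ, 0 ≤ gV τ := fun τ => mul_nonneg (norm_nonneg _) (add_nonneg
      (Finset.sum_nonneg fun τ₂ _ => by split_ifs <;> positivity) (Finset.sum_nonneg fun τ₁ _ => by split_ifs <;> positivity))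
    calc ‖∑ τ' : Triple e PH PS, ∑ τ : Triple e PH PS, (if τ.b = τ'.b then
          κ τ' * conj (κ τ) * Kt τ' τ * ((pairCutoffDefect κ τ' τ : ℝ) : ℂ) else 0)‖
        ≤ ∑ τ' : Triple e PH PS, ∑ τ : Triple e PH PS, (if τ.b = τ'.b then
            ‖κ τ'‖ * ‖κ τ‖ * ‖Kt τ' τ‖ * (cutoffDefect κ τ' + cutoffDefect κ τ) else 0) := by
          refine norm_sum_le_of_le _ fun τ' _ => norm_sum_le_of_le _ fun τ _ => ?_
          split_ifs with hb
          · rw [norm_mul, norm_mul, norm_mul, Complex.norm_conj, Complex.norm_real,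
              Real.norm_of_nonneg (pairCutoffDefect_nonneg_le κ τ' τ).1]
            exact mul_le_mul_of_nonneg_left (pairCutoffDefect_nonneg_le κ τ' τ).2 (by positivity)
          · rw [norm_zero]
      _ = (∑ τ' : Triple e PH PS, cutoffDefect κ τ' * (‖κ τ'‖ * ∑ τ : Triple e PH PS, (if τ.b = τ'.b then ‖κ τ‖ * ‖Kt τ' τ‖ else 0))) +
          ∑ τ : Triple e PH PS, cutoffDefect κ τ * (‖κ τ‖ * ∑ τ' : Triple e PH PS, (if τ.b = τ'.b then ‖κ τ'‖ * ‖Kt τ' τ‖ else 0)) := by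
          have h1 : ∑ τ' : Triple e PH PS, ∑ τ : Triple e PH PS, (if τ.b = τ'.b then
              ‖κ τ'‖ * ‖κ τ‖ * ‖Kt τ' τ‖ * (cutoffDefect κ τ' + cutoffDefect κ τ) else 0) =
              ∑ τ' : Triple e PH PS, ∑ τ : Triple e PH PS, (if τ.b = τ'.b then
                ‖κ τ'‖ * ‖κ τ‖ * ‖Kt τ' τ‖ * cutoffDefect κ τ' else 0) +
              ∑ τ' : Triple e PH PS, ∑ τ : Triple e PH PS, (if τ.b = τ'.b then
                ‖κ τ'‖ * ‖κ τ‖ * ‖Kt τ' τ‖ * cutoffDefect κ τ else 0) := by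
            rw [← Finset.sum_add_distrib]
            refine Finset.sum_congr rfl fun τ' _ => ?_
            rw [← Finset.sum_add_distrib]
            refine Finset.sum_congr rfl fun τ _ => ?_
            split_ifs <;> ring
          rw [h1]
          congr 1
          · refine Finset.sum_congr rfl fun τ' _ => ?_
            rw [Finset.mul_sum, Finset.mul_sum]
            refine Finset.sum_congr rfl fun τ _ => ?_
            split_ifs <;> ring
          · rw [Finset.sum_comm]
            refine Finset.sum_congr rfl fun τ _ => ?_
            rw [Finset.mul_sum, Finset.mul_sum]
            refine Finset.sum_congr rfl fun τ' _ => ?_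
            split_ifs <;> ring
      _ = ∑ τ : Triple e PH PS, gV τ * cutoffDefect κ τ := by
          rw [← Finset.sum_add_distrib]
          refine Finset.sum_congr rfl fun τ _ => ?_
          simp only [hgV, eq_comm]
          ring
      _ ≤ (F₁ * ampNormSq κ + F₂) * cubicNormSq κ :=
          sum_mul_defect_le_weighted he κ gV hgV0 hF₁ hF₁le hF₂le
  -- the `B` part
  have hBle : B.re ≤ 16 * (W₀ * g₀ ^ 4) * (ampNormSq κ ^ 2 + ampNormSq κ) * cubicNormSq κ := by
    refine (Complex.re_le_norm B).trans (hB.trans ?_)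
    rw [mul_assoc (16 * (W₀ * g₀ ^ 4))]
    exact mul_le_mul_of_nonneg_left (sum_normSq_setCoeff_mul_card_sq_le' κ) (by positivity)
  have habs := Complex.abs_re_le_norm (∑ τ' : Triple e PH PS, ∑ τ : Triple e PH PS, (if τ.b = τ'.b then
      κ τ' * conj (κ τ) * Kt τ' τ * ((pairCutoffDefect κ τ' τ : ℝ) : ℂ) else 0))
  rw [abs_le] at habs
  nlinarith [habs.1, hpd, hBle]


end Blocks

/-! ### The assembly with decaying weights -/

section Final

variable [Fintype ι] {z : ι} {σ : ι → ι} {P : Finset ι} {N₀ : ℝ} {t : ι → ℝ}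

set_option maxHeartbeats 1000000 in
/-- **The trial functional of the cubic vector, reduced to scalars** (Props. 3.1–3.2 of [ibid.] with
symbolic main terms). For `ξ_ν = cubicVector e P_H P_S κ` and Bogoliubov–Weyl data as in
`norm_quarticForm_sub_main_le`, an even weight `ε ≥ 0` vanishing at the condensate and `L > 0`:
`∑_p ε_p‖A_pξ_ν‖² + Re(∑ c⟨A_qA_pξ_ν, A_{q'}A_{p'}ξ_ν⟩)/(2L³) ≤ ‖ξ_ν‖²·{[∑ε σ² + ∑_τ w̃_τ|κ_τ|²]`
`+ (2L³)⁻¹[Re C + Re ∑_{b=b'}κ_{τ'}conj(κ_τ)K̃ + √N₀ Re ∑_τ c̃_τ conj κ_τ] + (2L³)⁻¹·errors}`,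
the errors being explicit polynomials in `K₁ = ∑|κ|²` and the sup parameters
(`W₀, g₀, s₀, gs₀, Λ, ∑σ², ∑_{P_H∪P_S}σ², |P_S|` and the four coincidence sups `F₁, F₂, F₁^V, F₂^V`
of the decaying weights): the kinetic constant and
`⟨𝒦⟩ + E₁`, the constants `ℒ^{(0)} + 𝒢^{(2,V)} + C_{G₂} + C_{G₃}` of `C_{𝒢_N}`, the main terms of
`⟨𝒱_N^{(H)}⟩` and `⟨𝒞_N⟩`, and the error terms of §4–§5 with `‖𝒩^{1/2}ξ_ν‖² ≤ 3K₁‖ξ_ν‖²`,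
`‖𝒩ξ_ν‖²-type ≤ 9(K₁²+K₁)‖ξ_ν‖²` inserted.
[cite: BastiCenatiempoSchlein2021, Prop. 3.1, Prop. 3.2, §4, §5] -/
theorem trialNumerator_cubicVector_le''
    (hσ : Function.Involutive σ) (hP : ∀ p ∈ P, σ p ∉ P) (hσz : σ z = z)
    (he : Function.Injective e) (hez : e z = 0) (heσ : ∀ p, e (σ p) = -e p) (hN₀ : 0 ≤ N₀)
    (W : Momentum → ℂ) {W₀ : ℝ} (hW : ∀ k, ‖W k‖ ≤ W₀) (hWev : ∀ k, W (-k) = W k)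
    (hHS : Disjoint PH PS) (hzH : z ∉ PH) (hzS : z ∉ PS) (hQσ : ∀ p ∈ PH ∪ PS, σ p ∈ PH ∪ PS)
    {g₀ s₀ gs₀ Λ : ℝ} (hg₀ : 0 ≤ g₀) (hs₀ : 0 ≤ s₀) (hgs₀ : 0 ≤ gs₀)
    (hgQ : ∀ p ∈ PH ∪ PS, |bogGamma σ P t p| ≤ g₀) (hsQ : ∀ p ∈ PH ∪ PS, |bogSigma σ P t p| ≤ s₀)
    (hgsQ : ∀ p ∈ PH ∪ PS, |bogGamma σ P t p * bogSigma σ P t p| ≤ gs₀)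
    (hΛle : ∀ k, ∑ p, ‖W (k - e p)‖ * |bogGamma σ P t p * bogSigma σ P t p| ≤ Λ)
    (κ : Triple e PH PS → ℂ) (ε : ι → ℝ) (hε : ∀ p, 0 ≤ ε p) (hεσ : ∀ p, ε (σ p) = ε p) (hεz : ε z = 0)
    {L : ℝ} (hL : 0 < L) {F₁ F₂ F₁V F₂V : ℝ} (hF₁ : 0 ≤ F₁) (hF₁V : 0 ≤ F₁V)
    (hF₁le : ∀ τ' : Triple e PH PS, ∑ τ : Triple e PH PS,
      (if τ.b = τ'.b ∨ (∃ p, (p = τ.u ∨ p = τ.a) ∧ (p = τ'.u ∨ p = τ'.a)) ∨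
          (∃ p, (p = τ.u ∨ p = τ.a) ∧ e p + e p + e τ'.b = 0) ∨ (∃ p', (p' = τ'.u ∨ p' = τ'.a) ∧ e p' + e p' + e τ.b = 0)
        then ‖arrSum (cubicCoeff e W (bogGamma σ P t) (bogSigma σ P t)) τ‖ * ‖κ τ‖ else 0) ≤ F₁)
    (hF₂le : ∑ τj : Triple e PH PS, ∑ τk : Triple e PH PS, ‖κ τj‖ ^ 2 * ‖κ τk‖ ^ 2 * ∑ τ : Triple e PH PS,
      (if (∃ pj pk, (pj = τj.u ∨ pj = τj.a) ∧ (pk = τk.u ∨ pk = τk.a) ∧ e pj + e pk + e τ.b = 0) ∨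
          (∃ p pk, (p = τ.u ∨ p = τ.a) ∧ (pk = τk.u ∨ pk = τk.a) ∧ e p + e pk + e τj.b = 0)
        then ‖arrSum (cubicCoeff e W (bogGamma σ P t) (bogSigma σ P t)) τ‖ * ‖κ τ‖ else 0) ≤ F₂)
    (hF₁Vle : ∀ τ' : Triple e PH PS, ∑ τ : Triple e PH PS,
      (if τ.b = τ'.b ∨ (∃ p, (p = τ.u ∨ p = τ.a) ∧ (p = τ'.u ∨ p = τ'.a)) ∨
          (∃ p, (p = τ.u ∨ p = τ.a) ∧ e p + e p + e τ'.b = 0) ∨ (∃ p', (p' = τ'.u ∨ p' = τ'.a) ∧ e p' + e p' + e τ.b = 0)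
        then (‖κ τ‖ * ((∑ τ₂ : Triple e PH PS, (if τ₂.b = τ.b then ‖κ τ₂‖ * ‖(hardKernel e W (bogGamma σ P t) PH τ₂.u τ₂.a τ.u τ.a +
            hardKernel e W (bogGamma σ P t) PH τ₂.u τ₂.a τ.a τ.u + hardKernel e W (bogGamma σ P t) PH τ₂.a τ₂.u τ.u τ.a +
            hardKernel e W (bogGamma σ P t) PH τ₂.a τ₂.u τ.a τ.u)‖ else 0)) +
          ∑ τ₁ : Triple e PH PS, (if τ.b = τ₁.b then ‖κ τ₁‖ * ‖(hardKernel e W (bogGamma σ P t) PH τ.u τ.a τ₁.u τ₁.a +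
            hardKernel e W (bogGamma σ P t) PH τ.u τ.a τ₁.a τ₁.u + hardKernel e W (bogGamma σ P t) PH τ.a τ.u τ₁.u τ₁.a +
            hardKernel e W (bogGamma σ P t) PH τ.a τ.u τ₁.a τ₁.u)‖ else 0))) else 0) ≤ F₁V)
    (hF₂Vle : ∑ τj : Triple e PH PS, ∑ τk : Triple e PH PS, ‖κ τj‖ ^ 2 * ‖κ τk‖ ^ 2 * ∑ τ : Triple e PH PS,
      (if (∃ pj pk, (pj = τj.u ∨ pj = τj.a) ∧ (pk = τk.u ∨ pk = τk.a) ∧ e pj + e pk + e τ.b = 0) ∨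
          (∃ p pk, (p = τ.u ∨ p = τ.a) ∧ (pk = τk.u ∨ pk = τk.a) ∧ e p + e pk + e τj.b = 0)
        then (‖κ τ‖ * ((∑ τ₂ : Triple e PH PS, (if τ₂.b = τ.b then ‖κ τ₂‖ * ‖(hardKernel e W (bogGamma σ P t) PH τ₂.u τ₂.a τ.u τ.a +
            hardKernel e W (bogGamma σ P t) PH τ₂.u τ₂.a τ.a τ.u + hardKernel e W (bogGamma σ P t) PH τ₂.a τ₂.u τ.u τ.a +
            hardKernel e W (bogGamma σ P t) PH τ₂.a τ₂.u τ.a τ.u)‖ else 0)) +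
          ∑ τ₁ : Triple e PH PS, (if τ.b = τ₁.b then ‖κ τ₁‖ * ‖(hardKernel e W (bogGamma σ P t) PH τ.u τ.a τ₁.u τ₁.a +
            hardKernel e W (bogGamma σ P t) PH τ.u τ.a τ₁.a τ₁.u + hardKernel e W (bogGamma σ P t) PH τ.a τ.u τ₁.u τ₁.a +
            hardKernel e W (bogGamma σ P t) PH τ.a τ.u τ₁.a τ₁.u)‖ else 0))) else 0) ≤ F₂V) :
    (∑ p, ε p * (fockInner (conjAn z σ P N₀ t p (cubicVector e PH PS κ)) (conjAn z σ P N₀ t p (cubicVector e PH PS κ))).re) +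
      (∑ p, ∑ q, ∑ p', ∑ q', pairCoeff' e W p q p' q' *
        fockInner (conjAn z σ P N₀ t q (conjAn z σ P N₀ t p (cubicVector e PH PS κ)))
          (conjAn z σ P N₀ t q' (conjAn z σ P N₀ t p' (cubicVector e PH PS κ)))).re / (2 * L ^ 3) ≤
      -- kinetic: constant + `⟨𝒦⟩ + E₁`
      ((∑ p, ε p * bogSigma σ P t p ^ 2) +
        ∑ τ : Triple e PH PS, (ε τ.u * (bogGamma σ P t τ.u ^ 2 + bogSigma σ P t τ.u ^ 2) +
          ε τ.a * (bogGamma σ P t τ.a ^ 2 + bogSigma σ P t τ.a ^ 2) +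
          ε τ.b * (bogGamma σ P t τ.b ^ 2 + bogSigma σ P t τ.b ^ 2)) * ‖κ τ‖ ^ 2) * cubicNormSq κ +
      ( -- main terms of the quartic form: hard block, cubic block, constants
        (∑ τ' : Triple e PH PS, ∑ τ : Triple e PH PS, (if τ.b = τ'.b then
          κ τ' * conj (κ τ) * (hardKernel e W (bogGamma σ P t) PH τ.u τ.a τ'.u τ'.a +
            hardKernel e W (bogGamma σ P t) PH τ.u τ.a τ'.a τ'.u + hardKernel e W (bogGamma σ P t) PH τ.a τ.u τ'.u τ'.a +
            hardKernel e W (bogGamma σ P t) PH τ.a τ.u τ'.a τ'.u) else 0)).re * cubicNormSq κ +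
        Real.sqrt N₀ * ((∑ τ : Triple e PH PS, arrSum (cubicCoeff e W (bogGamma σ P t) (bogSigma σ P t)) τ * conj (κ τ)).re *
          cubicNormSq κ) +
        ((N₀ : ℂ) ^ 2 * W 0 +
          (N₀ : ℂ) * (∑ p, ((2 * W 0 + W (e p) + W (-e p)) * ((bogSigma σ P t p ^ 2 : ℝ) : ℂ) +
            (W (e p) + W (-e p)) * ((bogGamma σ P t p * bogSigma σ P t p : ℝ) : ℂ))) +
          (∑ p, ∑ p', W (e p' - e p) *
            (((bogGamma σ P t p * bogSigma σ P t p * (bogGamma σ P t p' * bogSigma σ P t p')) : ℝ) : ℂ)) +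
          ((∑ p, ∑ q, W (e q - e p) * (((bogSigma σ P t p ^ 2 * bogSigma σ P t q ^ 2 : ℝ)) : ℂ)) +
            W 0 * ((((∑ p, bogSigma σ P t p ^ 2) ^ 2 : ℝ)) : ℂ))).re * cubicNormSq κ +
        -- errors
        (((F₁V * ampNormSq κ + F₂V) +
            16 * (W₀ * g₀ ^ 4) * (ampNormSq κ ^ 2 + ampNormSq κ)) * cubicNormSq κ +
          Real.sqrt N₀ * ((F₁ * ampNormSq κ + F₂) * cubicNormSq κ) +
          ((N₀ * (4 * W₀ * (g₀ ^ 2 + s₀ ^ 2 + gs₀)) + 4 * gs₀ * Λ + 4 * W₀ * (∑ p, bogSigma σ P t p ^ 2) * g₀ ^ 2 +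
              4 * W₀ * (∑ p, bogSigma σ P t p ^ 2) * s₀ ^ 2) * (3 * ampNormSq κ * cubicNormSq κ) +
            (4 * W₀ * g₀ ^ 2 * (∑ p, bogSigma σ P t p ^ 2) + W₀ * s₀ ^ 2 * (∑ p ∈ PH ∪ PS, bogSigma σ P t p ^ 2) +
              2 * W₀ * g₀ ^ 4 * PS.card) * (9 * ((ampNormSq κ ^ 2 + ampNormSq κ) * cubicNormSq κ))))) / (2 * L ^ 3) := by
  set ξ := cubicVector e PH PS κ with hξdef
  have hNre : (fockInner ξ ξ).re = cubicNormSq κ := cubicNormSq_eq hHS κ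
  have hNξ : fockInner ξ ξ = ((cubicNormSq κ : ℝ) : ℂ) := by rw [fockInner_self_eq_re, hNre]
  have hN0 : 0 ≤ cubicNormSq κ := cubicNormSq_nonneg κ
  have hK0 : 0 ≤ ampNormSq κ := ampNormSq_nonneg κ
  have hW₀ : 0 ≤ W₀ := le_trans (norm_nonneg _) (hW 0)
  -- (1) kinetic
  have hK := kinetic_cubicVector_le (N₀ := N₀) (t := t) hσ hP hHS κ ε hε hεσ hεz
  rw [hNre] at hK
  -- (2) the quartic form: main terms and errors
  have h1 : (1 : ZMod 3) ≠ 0 := by decide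
  have h2 : 2 • (1 : ZMod 3) ≠ 0 := by decide
  have h4 : 4 • (1 : ZMod 3) ≠ 0 := by decide
  have hQ := norm_quarticForm_sub_main_le h1 h2 h4 hσ hP hσz he hez heσ hN₀ W hW hWev hHS hzH hzS hQσ hg₀ hs₀ hgs₀
    hgQ hsQ hgsQ hΛle (isWeightedHomogeneous_cubicVector_zmod3 κ) (isWeightedHomogeneous_cubicVector_hs hHS κ)
    (fun p hp => pderiv_cubicVector_eq_zero_of_not_mem_union κ hp)
  rw [← hξdef] at hQ
  -- moments
  have hM₁ : ∑ p, (fockInner (pderiv p ξ) (pderiv p ξ)).re ≤ 3 * ampNormSq κ * cubicNormSq κ := by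
    have h := sum_mul_fockInner_pderiv_cubicVector_le hHS κ (fun _ => (1 : ℝ)) (fun _ => zero_le_one)
    simp only [one_mul, hξdef] at h ⊢
    rw [hNre] at h
    refine h.trans (le_of_eq ?_)
    have h3 : ∑ τ : Triple e PH PS, ((1 : ℝ) + 1 + 1) * ‖κ τ‖ ^ 2 = 3 * ampNormSq κ := by
      unfold ampNormSq; rw [Finset.mul_sum]; exact Finset.sum_congr rfl fun τ _ => by ring
    rw [h3]
  have hM₂ : ∑ x, ∑ y, (fockInner (pderiv y (pderiv x ξ)) (pderiv y (pderiv x ξ))).re ≤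
      9 * ((ampNormSq κ ^ 2 + ampNormSq κ) * cubicNormSq κ) :=
    (sum_sum_fockInner_pderiv_pderiv_cubicVector_le hHS κ).trans
      (mul_le_mul_of_nonneg_left (sum_normSq_setCoeff_mul_card_sq_le' κ) (by norm_num))
  -- the two symbolic blocks
  have hB := re_hardBlock_cubicVector_le'' (σ := σ) (P := P) (t := t) he hHS κ W hW hg₀ hF₁V
    (fun p hp => hgQ p (Finset.mem_union_left _ hp)) hF₁Vle hF₂Vle
  have hC := re_cubicBlock_cubicVector_le'' (σ := σ) (P := P) (t := t) he hHS κ W hF₁ hF₁le hF₂le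
  rw [← hξdef] at hB hC
  -- real part of the main term
  have hsq : 0 ≤ Real.sqrt N₀ := Real.sqrt_nonneg _
  have hre := re_le_re_add_norm_sub
    (∑ p, ∑ q, ∑ p', ∑ q', pairCoeff' e W p q p' q' *
      fockInner (conjAn z σ P N₀ t q (conjAn z σ P N₀ t p ξ)) (conjAn z σ P N₀ t q' (conjAn z σ P N₀ t p' ξ)))
    ((∑ p ∈ PH, ∑ q ∈ PH, ∑ p' ∈ PH, ∑ q' ∈ PH, pairCoeff' e W p q p' q' *
          ((bogGamma σ P t q * bogGamma σ P t p * (bogGamma σ P t q' * bogGamma σ P t p') : ℝ) : ℂ) *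
            fockInner (pderiv q (pderiv p ξ)) (pderiv q' (pderiv p' ξ))) +
        (Real.sqrt N₀ : ℂ) * (∑ i, ∑ j, ∑ k, (if e i + e j + e k = 0 then
          ((W (-e k) + W (e j)) * ((bogGamma σ P t i * bogSigma σ P t j * bogSigma σ P t k : ℝ) : ℂ) +
              (W (-e i) + W (e j)) * ((bogGamma σ P t i * bogGamma σ P t j * bogSigma σ P t k : ℝ) : ℂ)) *
            fockInner ξ (X i * (X j * (X k * ξ))) +
          ((W (e k) + W (-e j)) * ((bogGamma σ P t i * bogSigma σ P t j * bogSigma σ P t k : ℝ) : ℂ) +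
              (W (e i) + W (-e j)) * ((bogGamma σ P t i * bogGamma σ P t j * bogSigma σ P t k : ℝ) : ℂ)) *
            fockInner (X i * (X j * (X k * ξ))) ξ else 0)) +
        ((N₀ : ℂ) ^ 2 * W 0 +
          (N₀ : ℂ) * (∑ p, ((2 * W 0 + W (e p) + W (-e p)) * ((bogSigma σ P t p ^ 2 : ℝ) : ℂ) +
            (W (e p) + W (-e p)) * ((bogGamma σ P t p * bogSigma σ P t p : ℝ) : ℂ))) +
          (∑ p, ∑ p', W (e p' - e p) *
            (((bogGamma σ P t p * bogSigma σ P t p * (bogGamma σ P t p' * bogSigma σ P t p')) : ℝ) : ℂ)) +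
          ((∑ p, ∑ q, W (e q - e p) * (((bogSigma σ P t p ^ 2 * bogSigma σ P t q ^ 2 : ℝ)) : ℂ)) +
            W 0 * ((((∑ p, bogSigma σ P t p ^ 2) ^ 2 : ℝ)) : ℂ))) * fockInner ξ ξ)
  rw [hNξ] at hre hQ
  have hmain_re : ((∑ p ∈ PH, ∑ q ∈ PH, ∑ p' ∈ PH, ∑ q' ∈ PH, pairCoeff' e W p q p' q' *
          ((bogGamma σ P t q * bogGamma σ P t p * (bogGamma σ P t q' * bogGamma σ P t p') : ℝ) : ℂ) *
            fockInner (pderiv q (pderiv p ξ)) (pderiv q' (pderiv p' ξ))) +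
        (Real.sqrt N₀ : ℂ) * (∑ i, ∑ j, ∑ k, (if e i + e j + e k = 0 then
          ((W (-e k) + W (e j)) * ((bogGamma σ P t i * bogSigma σ P t j * bogSigma σ P t k : ℝ) : ℂ) +
              (W (-e i) + W (e j)) * ((bogGamma σ P t i * bogGamma σ P t j * bogSigma σ P t k : ℝ) : ℂ)) *
            fockInner ξ (X i * (X j * (X k * ξ))) +
          ((W (e k) + W (-e j)) * ((bogGamma σ P t i * bogSigma σ P t j * bogSigma σ P t k : ℝ) : ℂ) +
              (W (e i) + W (-e j)) * ((bogGamma σ P t i * bogGamma σ P t j * bogSigma σ P t k : ℝ) : ℂ)) *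
            fockInner (X i * (X j * (X k * ξ))) ξ else 0)) +
        ((N₀ : ℂ) ^ 2 * W 0 +
          (N₀ : ℂ) * (∑ p, ((2 * W 0 + W (e p) + W (-e p)) * ((bogSigma σ P t p ^ 2 : ℝ) : ℂ) +
            (W (e p) + W (-e p)) * ((bogGamma σ P t p * bogSigma σ P t p : ℝ) : ℂ))) +
          (∑ p, ∑ p', W (e p' - e p) *
            (((bogGamma σ P t p * bogSigma σ P t p * (bogGamma σ P t p' * bogSigma σ P t p')) : ℝ) : ℂ)) +
          ((∑ p, ∑ q, W (e q - e p) * (((bogSigma σ P t p ^ 2 * bogSigma σ P t q ^ 2 : ℝ)) : ℂ)) +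
            W 0 * ((((∑ p, bogSigma σ P t p ^ 2) ^ 2 : ℝ)) : ℂ))) * ((cubicNormSq κ : ℝ) : ℂ)).re =
      ((∑ p ∈ PH, ∑ q ∈ PH, ∑ p' ∈ PH, ∑ q' ∈ PH, pairCoeff' e W p q p' q' *
          ((bogGamma σ P t q * bogGamma σ P t p * (bogGamma σ P t q' * bogGamma σ P t p') : ℝ) : ℂ) *
            fockInner (pderiv q (pderiv p ξ)) (pderiv q' (pderiv p' ξ)))).re +
        Real.sqrt N₀ * ((∑ i, ∑ j, ∑ k, (if e i + e j + e k = 0 then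
          ((W (-e k) + W (e j)) * ((bogGamma σ P t i * bogSigma σ P t j * bogSigma σ P t k : ℝ) : ℂ) +
              (W (-e i) + W (e j)) * ((bogGamma σ P t i * bogGamma σ P t j * bogSigma σ P t k : ℝ) : ℂ)) *
            fockInner ξ (X i * (X j * (X k * ξ))) +
          ((W (e k) + W (-e j)) * ((bogGamma σ P t i * bogSigma σ P t j * bogSigma σ P t k : ℝ) : ℂ) +
              (W (e i) + W (-e j)) * ((bogGamma σ P t i * bogGamma σ P t j * bogSigma σ P t k : ℝ) : ℂ)) *
            fockInner (X i * (X j * (X k * ξ))) ξ else 0))).re +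
        (((N₀ : ℂ) ^ 2 * W 0 +
          (N₀ : ℂ) * (∑ p, ((2 * W 0 + W (e p) + W (-e p)) * ((bogSigma σ P t p ^ 2 : ℝ) : ℂ) +
            (W (e p) + W (-e p)) * ((bogGamma σ P t p * bogSigma σ P t p : ℝ) : ℂ))) +
          (∑ p, ∑ p', W (e p' - e p) *
            (((bogGamma σ P t p * bogSigma σ P t p * (bogGamma σ P t p' * bogSigma σ P t p')) : ℝ) : ℂ)) +
          ((∑ p, ∑ q, W (e q - e p) * (((bogSigma σ P t p ^ 2 * bogSigma σ P t q ^ 2 : ℝ)) : ℂ)) +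
            W 0 * ((((∑ p, bogSigma σ P t p ^ 2) ^ 2 : ℝ)) : ℂ)))).re * cubicNormSq κ := by
    simp only [Complex.add_re, Complex.re_ofReal_mul, Complex.re_mul_ofReal, add_mul]
  rw [hmain_re] at hre
  -- error of the quartic form in terms of `K₁`
  have hM₁0 : 0 ≤ ∑ p, (fockInner (pderiv p ξ) (pderiv p ξ)).re := Finset.sum_nonneg fun p _ => fockInner_self_re_nonneg _
  have hM₂0 : 0 ≤ ∑ x, ∑ y, (fockInner (pderiv y (pderiv x ξ)) (pderiv y (pderiv x ξ))).re :=
    Finset.sum_nonneg fun x _ => Finset.sum_nonneg fun y _ => fockInner_self_re_nonneg _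
  have hS20 : 0 ≤ ∑ p, bogSigma σ P t p ^ 2 := Finset.sum_nonneg fun p _ => sq_nonneg _
  have hS2Q0 : 0 ≤ ∑ p ∈ PH ∪ PS, bogSigma σ P t p ^ 2 := Finset.sum_nonneg fun p _ => sq_nonneg _
  have hΛ0 : 0 ≤ Λ := le_trans (Finset.sum_nonneg fun p _ => mul_nonneg (norm_nonneg _) (abs_nonneg _)) (hΛle 0)
  have hERR : N₀ * (4 * W₀ * (g₀ ^ 2 + s₀ ^ 2 + gs₀) * ∑ p, (fockInner (pderiv p ξ) (pderiv p ξ)).re) +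
      (4 * gs₀ * Λ * ∑ p, (fockInner (pderiv p ξ) (pderiv p ξ)).re +
        4 * W₀ * (∑ p, bogSigma σ P t p ^ 2) * g₀ ^ 2 * ∑ p, (fockInner (pderiv p ξ) (pderiv p ξ)).re +
        4 * W₀ * g₀ ^ 2 * (∑ p, bogSigma σ P t p ^ 2) *
          ∑ x, ∑ y, (fockInner (pderiv y (pderiv x ξ)) (pderiv y (pderiv x ξ))).re) +
      (4 * W₀ * (∑ p, bogSigma σ P t p ^ 2) * s₀ ^ 2 * ∑ p, (fockInner (pderiv p ξ) (pderiv p ξ)).re +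
        W₀ * s₀ ^ 2 * (∑ p ∈ PH ∪ PS, bogSigma σ P t p ^ 2) *
          ∑ x, ∑ y, (fockInner (pderiv y (pderiv x ξ)) (pderiv y (pderiv x ξ))).re) +
      2 * W₀ * g₀ ^ 4 * PS.card * ∑ x, ∑ y, (fockInner (pderiv y (pderiv x ξ)) (pderiv y (pderiv x ξ))).re ≤
      (N₀ * (4 * W₀ * (g₀ ^ 2 + s₀ ^ 2 + gs₀)) + 4 * gs₀ * Λ + 4 * W₀ * (∑ p, bogSigma σ P t p ^ 2) * g₀ ^ 2 +
          4 * W₀ * (∑ p, bogSigma σ P t p ^ 2) * s₀ ^ 2) * (3 * ampNormSq κ * cubicNormSq κ) +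
        (4 * W₀ * g₀ ^ 2 * (∑ p, bogSigma σ P t p ^ 2) + W₀ * s₀ ^ 2 * (∑ p ∈ PH ∪ PS, bogSigma σ P t p ^ 2) +
          2 * W₀ * g₀ ^ 4 * PS.card) * (9 * ((ampNormSq κ ^ 2 + ampNormSq κ) * cubicNormSq κ)) :=
    errQ_le_of_moments hN₀ hW₀ hgs₀ hΛ0 hS20 hS2Q0 (Nat.cast_nonneg _) (by linarith [hM₁]) hM₂
  -- combine
  have h2L : 0 < 2 * L ^ 3 := by positivity
  have hQre : (∑ p, ∑ q, ∑ p', ∑ q', pairCoeff' e W p q p' q' *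
      fockInner (conjAn z σ P N₀ t q (conjAn z σ P N₀ t p ξ)) (conjAn z σ P N₀ t q' (conjAn z σ P N₀ t p' ξ))).re ≤
      (∑ τ' : Triple e PH PS, ∑ τ : Triple e PH PS, (if τ.b = τ'.b then
          κ τ' * conj (κ τ) * (hardKernel e W (bogGamma σ P t) PH τ.u τ.a τ'.u τ'.a +
            hardKernel e W (bogGamma σ P t) PH τ.u τ.a τ'.a τ'.u + hardKernel e W (bogGamma σ P t) PH τ.a τ.u τ'.u τ'.a +
            hardKernel e W (bogGamma σ P t) PH τ.a τ.u τ'.a τ'.u) else 0)).re * cubicNormSq κ +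
        Real.sqrt N₀ * ((∑ τ : Triple e PH PS, arrSum (cubicCoeff e W (bogGamma σ P t) (bogSigma σ P t)) τ * conj (κ τ)).re *
          cubicNormSq κ) +
        ((N₀ : ℂ) ^ 2 * W 0 +
          (N₀ : ℂ) * (∑ p, ((2 * W 0 + W (e p) + W (-e p)) * ((bogSigma σ P t p ^ 2 : ℝ) : ℂ) +
            (W (e p) + W (-e p)) * ((bogGamma σ P t p * bogSigma σ P t p : ℝ) : ℂ))) +
          (∑ p, ∑ p', W (e p' - e p) *
            (((bogGamma σ P t p * bogSigma σ P t p * (bogGamma σ P t p' * bogSigma σ P t p')) : ℝ) : ℂ)) +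
          ((∑ p, ∑ q, W (e q - e p) * (((bogSigma σ P t p ^ 2 * bogSigma σ P t q ^ 2 : ℝ)) : ℂ)) +
            W 0 * ((((∑ p, bogSigma σ P t p ^ 2) ^ 2 : ℝ)) : ℂ))).re * cubicNormSq κ +
        (((F₁V * ampNormSq κ + F₂V) +
            16 * (W₀ * g₀ ^ 4) * (ampNormSq κ ^ 2 + ampNormSq κ)) * cubicNormSq κ +
          Real.sqrt N₀ * ((F₁ * ampNormSq κ + F₂) * cubicNormSq κ) +
          ((N₀ * (4 * W₀ * (g₀ ^ 2 + s₀ ^ 2 + gs₀)) + 4 * gs₀ * Λ + 4 * W₀ * (∑ p, bogSigma σ P t p ^ 2) * g₀ ^ 2 +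
              4 * W₀ * (∑ p, bogSigma σ P t p ^ 2) * s₀ ^ 2) * (3 * ampNormSq κ * cubicNormSq κ) +
            (4 * W₀ * g₀ ^ 2 * (∑ p, bogSigma σ P t p ^ 2) + W₀ * s₀ ^ 2 * (∑ p ∈ PH ∪ PS, bogSigma σ P t p ^ 2) +
              2 * W₀ * g₀ ^ 4 * PS.card) * (9 * ((ampNormSq κ ^ 2 + ampNormSq κ) * cubicNormSq κ)))) := by
    have hC' := mul_le_mul_of_nonneg_left hC hsq
    linarith [hre, hQ, hERR, hB, hC']
  have hdiv := div_le_div_of_nonneg_right hQre h2L.le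
  linarith [hK, hdiv]


end Final

end Fock

end Literature.MathematicalPhysics.QuantumManyBody.BoseGas

end
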